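import Summits.AtomisticToContinuum.HydrodynamicLimit.Theorems.MourreKoopmanChargesLinearToEntropyInBandVisCoreNToolkitB
import Literature.MathematicalPhysics.KineticTheory.HardSphereUniformGas
import HarnessLib

/-!
# Route `MourreKoopmanCharges`, crux `LinearToEntropyInBand` (stmt-AtomisticToContinuum-17740), skeleton v7:
# toolkit for the visible window functional `visCoreN` — part C (flux bounds, measurable good version, good-set additivity)

Registered toolkit stub `stub_visCoreNToolkitC` (`--supports` the crux; wave 6), completing parts A/B
(`…VisCoreNToolkit`, `…VisCoreNToolkitB`) for the v7 stubs 4a-i / 4a-ii (AUDIT-4a § 2 (d), (e3), § 3 item 5).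
No definition, no posited object; nothing restates the crux or a stub.

* § 1 THE BLOCK FIELDS AND THE FLUX PIECE (visible-particle bounds, AUDIT-4a § 2 (e3) / § 3 item 5): `cone` is the
  library `coneKernel` at radius `k(N+1)^{-1/3}` (unit mass for `0 < k(N+1)^{-1/3} < 1/2`, `integral_coneKernel`);
  `0 ≤ ρ̄`, `‖m̄‖ ≤ Vρ̄`, `0 ≤ ē ≤ V²ρ̄/2` (`V = K + ‖us‖_∞`); the flux density is bounded by `C_flux · ρ̄(x)` with
  `C_flux = a₀V + 3aV² + aV²Z_b + a₄V³(1/2 + Z_b/3)` as soon as the compressibility factor is bounded by `Z_b` on the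
  range `[0, 2ρs(x)σ³]` of the CAPPED EOS argument `min(ρ̄, 2ρs)σ³` (no landed global bound of `hsCompressibility`:
  in the band use `hsCompressibility_continuousOn` / `stub_hsCompressibility_linear`); hence at every configuration
  the flux density is integrable over `𝕋³` (so `visFluxN_add` applies) and `|flux(y)| ≤ (N+1) C_flux`.
* § 2 ASSEMBLY ON THE GOOD SET: the kinetic / flux orbit integrands are interval integrable (measurable in time,
  `IsHardSphereTrajectory.measurable_torus`, and bounded); `aemeasurable_visCoreN`: for `ε_N < 1/2`, `0 ≤ s` and
  measurable fields `visCoreN` is a.e.-measurable under every `μ` with `μ goodᶜ = 0` (on the good set it is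
  `w⁻¹(∫kin + collisionPairSum − ∫flux)`), e.g. `localGibbsLaw` (landed `Theorems.localGibbsLaw_compl_good`
  of `…JParityClosureParityInBandEnergyTight`, = `localGibbsLaw_eq` + `localGibbsMeasure_absolutelyContinuous`);
  `visCoreN_add_of_good`: additivity in continuous test fields at every good datum.

References: H.-T. Yau, Lett. Math. Phys. 22 (1991) § 2; H. Spohn, *Large Scale Dynamics of Interacting Particles*
(1991) Part I § 3.3; I. Gallagher, L. Saint-Raymond, B. Texier, *From Newton to Boltzmann* (2013) § 4.1.
-/

noncomputable section

open MeasureTheory Filter Set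
open scoped ENNReal Topology InnerProductSpace BigOperators

namespace Summit.AtomisticToContinuum.HydrodynamicLimit.Theorems.LTEInBand

open Literature.MathematicalPhysics.KineticTheory Literature.Analysis.FluidPDE Literature.Analysis.FunctionSpaces

/-! ## § 1 The block fields and the flux piece: nonnegativity, visible-particle bounds, integrability -/

section Flux

variable (ρs : T3 → ℝ) (us : T3 → V3) (R K : ℝ) (N : ℕ)

/-- The cone kernel of part A is the `coneKernel` of the kinetic-theory library at radius `k (N+1)^{-1/3}`. -/
theorem cone_eq_coneKernel (k : ℝ) (x y : T3) : cone k N x y = coneKernel (k * ((N : ℝ) + 1) ^ (-(1 / 3 : ℝ))) x y := by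
  unfold cone coneKernel; rw [max_comm]

/-- The cone kernel is nonnegative for a nonnegative radius parameter (`3/0 = 0` at `k = 0`). -/
theorem cone_nonneg {k : ℝ} (hk : 0 ≤ k) (x y : T3) : 0 ≤ cone k N x y := by
  unfold cone
  exact mul_nonneg (div_nonneg (by norm_num) (by positivity)) (le_max_left _ _)

/-- **The cone kernel has unit mass** for `0 < k (N+1)^{-1/3} < 1/2` (`integral_coneKernel`). -/
theorem integral_cone_eq_one {k : ℝ} (hk : 0 < k * ((N : ℝ) + 1) ^ (-(1 / 3 : ℝ)))
    (hk2 : k * ((N : ℝ) + 1) ^ (-(1 / 3 : ℝ)) < 1 / 2) (x₀ : T3) : ∫ x, cone k N x x₀ = 1 := by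
  simp_rw [cone_eq_coneKernel]; exact integral_coneKernel hk hk2 x₀

/-- The visible block density is nonnegative (`0 ≤ k`). -/
theorem visDensityN_nonneg {k : ℝ} (hk : 0 ≤ k) (y : Config (N + 1) (Fin 3) T3) (x : T3) : 0 ≤ visDensityN ρs us R K k N y x := by
  unfold visDensityN
  refine mul_nonneg (by positivity) (Finset.sum_nonneg fun i _ => ?_)
  split_ifs; exacts [cone_nonneg N hk _ _, le_rfl]

/-- Visible momentum is carried by slow particles: `‖m̄(x)‖ ≤ (K + U) ρ̄(x)` (`‖us‖_∞ ≤ U`, `0 ≤ k`). -/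
theorem norm_visMomentumN_le {us : T3 → V3} {K U k : ℝ} (hus : ∀ x, ‖us x‖ ≤ U) (hk : 0 ≤ k)
    (y : Config (N + 1) (Fin 3) T3) (x : T3) :
    ‖visMomentumN ρs us R K k N y x‖ ≤ (K + U) * visDensityN ρs us R K k N y x := by
  unfold visMomentumN visDensityN
  rw [norm_smul, norm_inv, Real.norm_of_nonneg (by positivity : (0 : ℝ) ≤ (N : ℝ) + 1), mul_left_comm]
  refine mul_le_mul_of_nonneg_left ?_ (by positivity)
  rw [Finset.mul_sum]
  refine (norm_sum_le _ _).trans (Finset.sum_le_sum fun i _ => ?_)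
  split_ifs with h
  · rw [norm_smul, Real.norm_of_nonneg (cone_nonneg N hk _ _), mul_comm]
    exact mul_le_mul_of_nonneg_right (norm_vel_le_of_visibleN ρs R N hus h) (cone_nonneg N hk _ _)
  · simp

/-- Visible kinetic energy: `0 ≤ ē(x) ≤ (K + U)²/2 · ρ̄(x)`. -/
theorem visEnergyN_mem_Icc {us : T3 → V3} {K U k : ℝ} (hus : ∀ x, ‖us x‖ ≤ U) (hk : 0 ≤ k)
    (y : Config (N + 1) (Fin 3) T3) (x : T3) :
    visEnergyN ρs us R K k N y x ∈ Set.Icc 0 ((K + U) ^ 2 / 2 * visDensityN ρs us R K k N y x) := by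
  unfold visEnergyN visDensityN
  constructor
  · refine mul_nonneg (by positivity) (Finset.sum_nonneg fun i _ => ?_)
    split_ifs; exacts [div_nonneg (mul_nonneg (cone_nonneg N hk _ _) (sq_nonneg _)) zero_le_two, le_rfl]
  · rw [mul_left_comm]
    refine mul_le_mul_of_nonneg_left ?_ (by positivity)
    rw [Finset.mul_sum]
    refine Finset.sum_le_sum fun i _ => ?_
    split_ifs with h
    · have hv := norm_vel_le_of_visibleN ρs R N hus h
      have hv2 : ‖(y i).2‖ ^ 2 ≤ (K + U) ^ 2 := pow_le_pow_left₀ (norm_nonneg _) hv 2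
      have hc := cone_nonneg N hk x (y i).1
      calc cone k N x (y i).1 * ‖(y i).2‖ ^ 2 / 2 ≤ cone k N x (y i).1 * (K + U) ^ 2 / 2 := by gcongr
        _ = (K + U) ^ 2 / 2 * cone k N x (y i).1 := by ring
    · simp

/-- **Density-weighted bound of the Euler-flux density of the visible block fields**: with `V = K + U ≥ 0`
(`‖us‖_∞ ≤ U`), `‖A₀‖_∞ ≤ a₀`, `‖A_j‖_∞ ≤ a`, `‖A₄‖_∞ ≤ a₄`, `0 ≤ k`, `0 ≤ σ`, `0 ≤ ρs` and the compressibility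
factor bounded by `Zb` on `[0, 2 ρs(x) σ³]` (the range of the capped EOS argument `min(ρ̄, 2ρs) σ³`; in the band
from `hsCompressibility_continuousOn` / `stub_hsCompressibility_linear`),
`|flux density(y, x)| ≤ (a₀ V + 3 a V² + a V² Zb + a₄ V³ (1/2 + Zb/3)) · ρ̄(y, x)`
(`‖m̄‖ ≤ V ρ̄`, `ē ≤ V² ρ̄/2`, `‖w̄‖ ≤ V`, `|p| ≤ V² Zb ρ̄/3`; junk `ρ̄⁻¹ = 0` included). -/
theorem abs_visFluxDensityN_le {σ : ℝ} {us : T3 → V3} {A₀ A₄ : T3 → V3} {A : Fin 3 → T3 → V3}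
    {K U k a₀ a a₄ Zb : ℝ} (hus : ∀ x, ‖us x‖ ≤ U) (hV : 0 ≤ K + U) (hk : 0 ≤ k) (hσ : 0 ≤ σ)
    (hA₀ : ∀ x, ‖A₀ x‖ ≤ a₀) (hA : ∀ j x, ‖A j x‖ ≤ a) (hA₄ : ∀ x, ‖A₄ x‖ ≤ a₄) (hρs : ∀ x, 0 ≤ ρs x)
    (hZ : ∀ x, ∀ η ∈ Set.Icc 0 (2 * ρs x * σ ^ 3), |hsCompressibility η| ≤ Zb)
    (y : Config (N + 1) (Fin 3) T3) (x : T3) :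
    |visFluxDensityN σ ρs us A₀ A₄ A R K k N y x| ≤
      (a₀ * (K + U) + 3 * a * (K + U) ^ 2 + a * (K + U) ^ 2 * Zb + a₄ * (K + U) ^ 3 * (1 / 2 + Zb / 3)) *
        visDensityN ρs us R K k N y x := by
  have ha₀ : 0 ≤ a₀ := (norm_nonneg _).trans (hA₀ 0)
  have ha : 0 ≤ a := (norm_nonneg _).trans (hA 0 0)
  have ha₄ : 0 ≤ a₄ := (norm_nonneg _).trans (hA₄ 0)
  have hZb : 0 ≤ Zb := (abs_nonneg _).trans (hZ 0 0 ⟨le_rfl, by have := hρs 0; positivity⟩)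
  unfold visFluxDensityN
  set ρ := visDensityN ρs us R K k N y x with hρdef
  set m := visMomentumN ρs us R K k N y x with hmdef
  set e := visEnergyN ρs us R K k N y x with hedef
  set V := K + U with hVdef
  have hρ0 : 0 ≤ ρ := visDensityN_nonneg ρs us R K N hk y x
  have hm : ‖m‖ ≤ V * ρ := norm_visMomentumN_le ρs R N hus hk y x
  obtain ⟨he0, he⟩ := visEnergyN_mem_Icc ρs R N hus hk y x
  dsimp only
  set wb : V3 := ρ⁻¹ • m with hwbdef
  set Z := hsCompressibility (min ρ (2 * ρs x) * σ ^ 3) with hZdef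
  set p : ℝ := ρ * (2 / 3 * (e / ρ - ‖wb‖ ^ 2 / 2)) * Z with hpdef
  -- elementary bounds of the block quantities
  have hwb : ‖wb‖ ≤ V := by
    rcases hρ0.eq_or_lt with hρz | hρpos
    · rw [hwbdef, ← hρz, inv_zero, zero_smul, norm_zero, hVdef]; exact hV
    · rw [hwbdef, norm_smul, norm_inv, Real.norm_of_nonneg hρ0]
      calc ρ⁻¹ * ‖m‖ ≤ ρ⁻¹ * (V * ρ) := mul_le_mul_of_nonneg_left hm (by positivity)
        _ = V := by field_simp
  have heρ : 0 ≤ e / ρ ∧ e / ρ ≤ V ^ 2 / 2 := by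
    rcases hρ0.eq_or_lt with hρz | hρpos
    exacts [by rw [← hρz, div_zero]; exact ⟨le_rfl, by positivity⟩, ⟨div_nonneg he0 hρ0, (div_le_iff₀ hρpos).2 he⟩]
  have hdiff : |e / ρ - ‖wb‖ ^ 2 / 2| ≤ V ^ 2 / 2 := by
    have hwb2 : ‖wb‖ ^ 2 / 2 ≤ V ^ 2 / 2 :=
      div_le_div_of_nonneg_right (pow_le_pow_left₀ (norm_nonneg _) hwb 2) zero_le_two
    rw [abs_sub_le_iff]
    constructor <;> nlinarith [heρ.1, heρ.2, sq_nonneg ‖wb‖]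
  have hZa : |Z| ≤ Zb := by
    refine hZ x _ ⟨mul_nonneg (le_min hρ0 (by have := hρs x; positivity)) (by positivity), ?_⟩
    exact mul_le_mul_of_nonneg_right (min_le_right _ _) (by positivity)
  have hp : |p| ≤ V ^ 2 * Zb / 3 * ρ := by
    rw [hpdef, abs_mul, abs_mul, abs_of_nonneg hρ0, abs_mul, abs_of_nonneg (by norm_num : (0 : ℝ) ≤ 2 / 3)]
    calc ρ * (2 / 3 * |e / ρ - ‖wb‖ ^ 2 / 2|) * |Z| ≤ ρ * (2 / 3 * (V ^ 2 / 2)) * Zb := by gcongr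
      _ = V ^ 2 * Zb / 3 * ρ := by ring
  have hwbj : ∀ j, |wb j| ≤ V := fun j => le_trans (by simpa using PiLp.norm_apply_le wb j) hwb
  have hAj : ∀ j, |A j x j| ≤ a := fun j => le_trans (by simpa using PiLp.norm_apply_le (A j x) j) (hA j x)
  -- the three groups of terms
  have h1 : |⟪A₀ x, m⟫_ℝ| ≤ a₀ * V * ρ := by
    calc |⟪A₀ x, m⟫_ℝ| ≤ ‖A₀ x‖ * ‖m‖ := abs_real_inner_le_norm _ _
      _ ≤ a₀ * (V * ρ) := mul_le_mul (hA₀ x) hm (norm_nonneg _) ha₀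
      _ = a₀ * V * ρ := by ring
  have h2 : |∑ j, (⟪A j x, m⟫_ℝ * wb j + p * A j x j)| ≤ 3 * (a * V ^ 2 + a * V ^ 2 * Zb / 3) * ρ := by
    refine (Finset.abs_sum_le_sum_abs _ _).trans ?_
    have h3 : ∑ _j : Fin 3, (a * V ^ 2 + a * V ^ 2 * Zb / 3) * ρ = 3 * (a * V ^ 2 + a * V ^ 2 * Zb / 3) * ρ := by
      rw [Finset.sum_const, Finset.card_univ, Fintype.card_fin, nsmul_eq_mul]
      push_cast; ring
    rw [← h3]
    refine Finset.sum_le_sum fun j _ => (abs_add_le _ _).trans ?_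
    rw [abs_mul, abs_mul, add_mul]
    refine add_le_add ?_ ?_
    · calc |⟪A j x, m⟫_ℝ| * |wb j| ≤ (a * (V * ρ)) * V :=
          mul_le_mul ((abs_real_inner_le_norm _ _).trans (mul_le_mul (hA j x) hm (norm_nonneg _) ha)) (hwbj j)
            (abs_nonneg _) (by positivity)
        _ = a * V ^ 2 * ρ := by ring
    · calc |p| * |A j x j| ≤ V ^ 2 * Zb / 3 * ρ * a := mul_le_mul hp (hAj j) (abs_nonneg _) (by positivity)
        _ = a * V ^ 2 * Zb / 3 * ρ := by ring
  have h3 : |⟪A₄ x, wb⟫_ℝ * (e + p)| ≤ a₄ * V ^ 3 * (1 / 2 + Zb / 3) * ρ := by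
    rw [abs_mul]
    have hep : |e + p| ≤ V ^ 2 / 2 * ρ + V ^ 2 * Zb / 3 * ρ :=
      (abs_add_le _ _).trans (add_le_add (by rw [abs_of_nonneg he0]; exact he) hp)
    calc |⟪A₄ x, wb⟫_ℝ| * |e + p| ≤ a₄ * V * (V ^ 2 / 2 * ρ + V ^ 2 * Zb / 3 * ρ) :=
        mul_le_mul ((abs_real_inner_le_norm _ _).trans (mul_le_mul (hA₄ x) hwb (norm_nonneg _) ha₄)) hep
          (abs_nonneg _) (by positivity)
      _ = a₄ * V ^ 3 * (1 / 2 + Zb / 3) * ρ := by ring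
  calc _ ≤ |⟪A₀ x, m⟫_ℝ| + |∑ j, (⟪A j x, m⟫_ℝ * wb j + p * A j x j)| + |⟪A₄ x, wb⟫_ℝ * (e + p)| :=
        (abs_add_le _ _).trans (add_le_add (abs_add_le _ _) le_rfl)
    _ ≤ a₀ * V * ρ + 3 * (a * V ^ 2 + a * V ^ 2 * Zb / 3) * ρ + a₄ * V ^ 3 * (1 / 2 + Zb / 3) * ρ :=
        add_le_add (add_le_add h1 h2) h3
    _ = _ := by ring

variable {ρs us R K N}

/-- At a fixed configuration the visible block density is integrable over `𝕋³` and, for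
`0 < k (N+1)^{-1/3} < 1/2`, has mass `#{visible}/(N+1) ≤ 1`. -/
theorem integrable_visDensityN_and_integral_le_one {k : ℝ} (hk : 0 < k * ((N : ℝ) + 1) ^ (-(1 / 3 : ℝ)))
    (hk2 : k * ((N : ℝ) + 1) ^ (-(1 / 3 : ℝ)) < 1 / 2) (y : Config (N + 1) (Fin 3) T3) :
    Integrable (fun x => visDensityN ρs us R K k N y x) ∧ ∫ x, visDensityN ρs us R K k N y x ≤ 1 := by
  have hk0 : 0 < k := pos_of_mul_pos_left hk (Real.rpow_nonneg (by positivity) _)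
  have hcont : ∀ x₀ : T3, Continuous fun x : T3 => cone k N x x₀ := fun x₀ => by
    unfold cone
    exact continuous_const.mul (continuous_const.max (continuous_const.sub
      ((Torus.continuous_euclidDist.comp (continuous_id.prodMk continuous_const)).div_const _)))
  have hint : ∀ x₀ : T3, Integrable fun x : T3 => cone k N x x₀ := fun x₀ =>
    (hcont x₀).integrable_of_hasCompactSupport (HasCompactSupport.of_compactSpace _)
  have hterm : ∀ i, Integrable fun x : T3 => if VisibleN ρs us R K N y i then cone k N x (y i).1 else 0 := by
    intro i
    by_cases h : VisibleN ρs us R K N y i <;> simp only [h, if_true, if_false]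
    exacts [hint _, integrable_const 0]
  refine ⟨(integrable_finsetSum _ fun i _ => hterm i).const_mul _, ?_⟩
  unfold visDensityN
  rw [integral_const_mul, integral_finsetSum _ fun i _ => hterm i]
  have hle : ∀ i, ∫ x : T3, (if VisibleN ρs us R K N y i then cone k N x (y i).1 else 0) ≤ 1 := by
    intro i
    by_cases h : VisibleN ρs us R K N y i <;> simp only [h, if_true, if_false, integral_const, smul_zero]
    exacts [(integral_cone_eq_one N hk hk2 _).le, zero_le_one]
  calc ((N : ℝ) + 1)⁻¹ * ∑ i, ∫ x : T3, (if VisibleN ρs us R K N y i then cone k N x (y i).1 else 0)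
      ≤ ((N : ℝ) + 1)⁻¹ * ∑ _i : Fin (N + 1), (1 : ℝ) :=
        mul_le_mul_of_nonneg_left (Finset.sum_le_sum fun i _ => hle i) (by positivity)
    _ = 1 := by
        rw [Finset.sum_const, Finset.card_univ, Fintype.card_fin, nsmul_eq_mul, mul_one]
        push_cast; exact inv_mul_cancel₀ (by positivity)

/-- **Integrability over `𝕋³` and visible-particle bound of the flux piece**: under the hypotheses of
`abs_visFluxDensityN_le`, measurable `ρs` and test fields, and `0 < k (N+1)^{-1/3} < 1/2`, at EVERY configuration
the flux density is integrable (so `visFluxN_add` applies) and `|flux(y)| ≤ (N+1) · C_flux`. -/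
theorem integrable_visFluxDensityN_and_abs_visFluxN_le {σ : ℝ} {A₀ A₄ : T3 → V3} {A : Fin 3 → T3 → V3}
    {U k a₀ a a₄ Zb : ℝ} (hρm : Measurable ρs) (husm : Measurable us) (hA₀m : Measurable A₀) (hA₄m : Measurable A₄)
    (hAm : ∀ j, Measurable (A j)) (hus : ∀ x, ‖us x‖ ≤ U) (hV : 0 ≤ K + U)
    (hk : 0 < k * ((N : ℝ) + 1) ^ (-(1 / 3 : ℝ))) (hk2 : k * ((N : ℝ) + 1) ^ (-(1 / 3 : ℝ)) < 1 / 2) (hσ : 0 ≤ σ)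
    (hA₀ : ∀ x, ‖A₀ x‖ ≤ a₀) (hA : ∀ j x, ‖A j x‖ ≤ a) (hA₄ : ∀ x, ‖A₄ x‖ ≤ a₄) (hρs : ∀ x, 0 ≤ ρs x)
    (hZ : ∀ x, ∀ η ∈ Set.Icc 0 (2 * ρs x * σ ^ 3), |hsCompressibility η| ≤ Zb) (y : Config (N + 1) (Fin 3) T3) :
    Integrable (visFluxDensityN σ ρs us A₀ A₄ A R K k N y) ∧
      |visFluxN σ ρs us A₀ A₄ A R K k N y| ≤ ((N : ℝ) + 1) *
        (a₀ * (K + U) + 3 * a * (K + U) ^ 2 + a * (K + U) ^ 2 * Zb + a₄ * (K + U) ^ 3 * (1 / 2 + Zb / 3)) := by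
  have hk0 : 0 < k := pos_of_mul_pos_left hk (Real.rpow_nonneg (by positivity) _)
  set C := a₀ * (K + U) + 3 * a * (K + U) ^ 2 + a * (K + U) ^ 2 * Zb + a₄ * (K + U) ^ 3 * (1 / 2 + Zb / 3) with hC
  obtain ⟨hρint, hρle⟩ := integrable_visDensityN_and_integral_le_one (ρs := ρs) (us := us) (R := R) (K := K) hk hk2 y
  have hbound : ∀ x, |visFluxDensityN σ ρs us A₀ A₄ A R K k N y x| ≤ C * visDensityN ρs us R K k N y x := fun x =>
    abs_visFluxDensityN_le ρs R N hus hV hk0.le hσ hA₀ hA hA₄ hρs hZ y x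
  have hmeas : Measurable (visFluxDensityN σ ρs us A₀ A₄ A R K k N y) := by
    simpa only [Function.comp_def, id_eq] using
      (measurable_visFluxDensityN hρm husm hA₀m hA₄m hAm R K k N).comp (measurable_const.prodMk measurable_id)
  have hint : Integrable (visFluxDensityN σ ρs us A₀ A₄ A R K k N y) :=
    Integrable.mono' (hρint.const_mul C) hmeas.aestronglyMeasurable
      (ae_of_all _ fun x => by rw [Real.norm_eq_abs]; exact hbound x)
  refine ⟨hint, ?_⟩
  have ha₀ : 0 ≤ a₀ := (norm_nonneg _).trans (hA₀ 0)
  have ha : 0 ≤ a := (norm_nonneg _).trans (hA 0 0)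
  have ha₄ : 0 ≤ a₄ := (norm_nonneg _).trans (hA₄ 0)
  have hZb : 0 ≤ Zb := (abs_nonneg _).trans (hZ 0 0 ⟨le_rfl, by have := hρs 0; positivity⟩)
  have hC0 : 0 ≤ C := by positivity
  unfold visFluxN
  rw [abs_mul, abs_of_nonneg (by positivity : (0 : ℝ) ≤ (N : ℝ) + 1)]
  refine mul_le_mul_of_nonneg_left ?_ (by positivity)
  calc |∫ x, visFluxDensityN σ ρs us A₀ A₄ A R K k N y x| ≤ ∫ x, C * visDensityN ρs us R K k N y x := by
        rw [← Real.norm_eq_abs]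
        exact norm_integral_le_of_norm_le (hρint.const_mul C) (ae_of_all _ fun x => by rw [Real.norm_eq_abs]; exact hbound x)
    _ ≤ C * 1 := by rw [integral_const_mul]; exact mul_le_mul_of_nonneg_left hρle hC0
    _ = C := mul_one C

end Flux

/-! ## § 2 Assembly on the good set: orbit integrability, a measurable good version, additivity -/

section Assembly

variable {σ : ℝ} {N : ℕ} {ρs : T3 → ℝ} {us : T3 → V3} {A₀ A₄ : T3 → V3} {A : Fin 3 → T3 → V3}

/-- **The kinetic piece along a good orbit is interval integrable** (measurable in time by
`IsHardSphereTrajectory.measurable_torus`, bounded by `abs_visKinN_le`; cf. `intervalIntegrable_of_bdd` of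
`Literature.Probability.Process.ProgressiveDensity`, inlined to keep the imports kinetic). -/
theorem intervalIntegrable_visKinN_flow {K U a₀ a a₄ : ℝ} (hρm : Measurable ρs) (husm : Measurable us)
    (hA₀m : Measurable A₀) (hA₄m : Measurable A₄) (hAm : ∀ j, Measurable (A j)) (hA₀ : ∀ x, ‖A₀ x‖ ≤ a₀)
    (hA : ∀ j x, ‖A j x‖ ≤ a) (hA₄ : ∀ x, ‖A₄ x‖ ≤ a₄) (hus : ∀ x, ‖us x‖ ≤ U) (hV : 0 ≤ K + U) (R : ℝ)
    (Φ : HardSphereFlow (Torus.geometry (Fin 3)) (hsDiameter σ N) (N + 1)) {z : Config (N + 1) (Fin 3) T3}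
    (hz : z ∈ Φ.good) (t₁ t₂ : ℝ) :
    IntervalIntegrable (fun r => visKinN ρs us A₀ A₄ A R K N (Φ.flow r z)) volume t₁ t₂ := by
  have hm : Measurable fun r => visKinN ρs us A₀ A₄ A R K N (Φ.flow r z) := by
    simpa only [Function.comp_def] using
      (measurable_visKinN hρm husm hA₀m hA₄m hAm R K N).comp (Φ.isTrajectory z hz).measurable_torus
  have hb := fun r => abs_visKinN_le ρs R N hA₀ hA hA₄ hus hV (Φ.flow r z)
  constructor <;> exact ⟨hm.aestronglyMeasurable, .of_bounded (ae_of_all _ fun r => (Real.norm_eq_abs _).le.trans (hb r))⟩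

/-- **The flux piece along a good orbit is interval integrable** (hypotheses of
`integrable_visFluxDensityN_and_abs_visFluxN_le`). -/
theorem intervalIntegrable_visFluxN_flow {K U k a₀ a a₄ Zb : ℝ} (hρm : Measurable ρs) (husm : Measurable us)
    (hA₀m : Measurable A₀) (hA₄m : Measurable A₄) (hAm : ∀ j, Measurable (A j)) (hus : ∀ x, ‖us x‖ ≤ U) (hV : 0 ≤ K + U)
    (hk : 0 < k * ((N : ℝ) + 1) ^ (-(1 / 3 : ℝ))) (hk2 : k * ((N : ℝ) + 1) ^ (-(1 / 3 : ℝ)) < 1 / 2) (hσ : 0 ≤ σ)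
    (hA₀ : ∀ x, ‖A₀ x‖ ≤ a₀) (hA : ∀ j x, ‖A j x‖ ≤ a) (hA₄ : ∀ x, ‖A₄ x‖ ≤ a₄) (hρs : ∀ x, 0 ≤ ρs x)
    (hZ : ∀ x, ∀ η ∈ Set.Icc 0 (2 * ρs x * σ ^ 3), |hsCompressibility η| ≤ Zb) (R : ℝ)
    (Φ : HardSphereFlow (Torus.geometry (Fin 3)) (hsDiameter σ N) (N + 1)) {z : Config (N + 1) (Fin 3) T3}
    (hz : z ∈ Φ.good) (t₁ t₂ : ℝ) :
    IntervalIntegrable (fun r => visFluxN σ ρs us A₀ A₄ A R K k N (Φ.flow r z)) volume t₁ t₂ := by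
  have hm : Measurable fun r => visFluxN σ ρs us A₀ A₄ A R K k N (Φ.flow r z) := by
    simpa only [Function.comp_def] using
      (measurable_visFluxN hρm husm hA₀m hA₄m hAm R K k N).comp (Φ.isTrajectory z hz).measurable_torus
  have hb := fun r => (integrable_visFluxDensityN_and_abs_visFluxN_le (R := R) hρm husm hA₀m hA₄m hAm hus hV hk hk2 hσ
    hA₀ hA hA₄ hρs hZ (Φ.flow r z)).2
  constructor <;> exact ⟨hm.aestronglyMeasurable, .of_bounded (ae_of_all _ fun r => (Real.norm_eq_abs _).le.trans (hb r))⟩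

/-- The collision piece in pair-sum form is a.e.-measurable under every law carried by the good set
(window `(s, t]`, `0 ≤ s`; measurable reference and test fields). -/
theorem aemeasurable_collisionPairSum_visCollTermN (hρm : Measurable ρs) (husm : Measurable us) (hA₄m : Measurable A₄)
    (hAm : ∀ j, Measurable (A j)) (R K : ℝ) (Φ : HardSphereFlow (Torus.geometry (Fin 3)) (hsDiameter σ N) (N + 1))
    {s : ℝ} (hs : 0 ≤ s) (t : ℝ) {μ : Measure (Config (N + 1) (Fin 3) T3)} (hμ : μ Φ.goodᶜ = 0) :
    AEMeasurable (fun z => Φ.collisionPairSum (Set.Ioc s t) (fun _ y i j =>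
      visCollTermN σ ρs us A₄ A R K N (collidePair (Torus.geometry (Fin 3)) i j y) y i) z) μ := by
  refine Φ.aemeasurable_of_measurable_comp_subtype (measurable_collisionPairSum_Ioc_comp_subtype Φ (fun i j => ?_) hs t) hμ
  simpa only [Function.comp_def, id_eq] using (measurable_visCollTermN hρm husm hA₄m hAm R K N i).comp
    ((Torus.isMeasurable_geometry.measurable_collidePair i j).prodMk measurable_id)

/-- **`visCoreN` has a measurable good version**: for `ε_N < 1/2`, `0 ≤ s` and measurable reference / test
fields, `z ↦ visCoreN … s z` is a.e.-measurable under every law `μ` carried by the good set (`μ goodᶜ = 0`: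
Liouville, `localGibbsLaw`) — on the good set it is `w⁻¹ (∫ kin + collisionPairSum − ∫ flux)` of three
(a.e.-)measurable functions (`HardSphereFlowJointMeasurable`, the enumeration engine above). -/
theorem aemeasurable_visCoreN (hε : hsDiameter σ N < 2⁻¹) (hρm : Measurable ρs) (husm : Measurable us)
    (hA₀m : Measurable A₀) (hA₄m : Measurable A₄) (hAm : ∀ j, Measurable (A j)) (R K τ k : ℝ)
    (Φ : HardSphereFlow (Torus.geometry (Fin 3)) (hsDiameter σ N) (N + 1)) {s : ℝ} (hs : 0 ≤ s)
    {μ : Measure (Config (N + 1) (Fin 3) T3)} (hμ : μ Φ.goodᶜ = 0) :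
    AEMeasurable (visCoreN σ ρs us A₀ A₄ A R K τ k N Φ s) μ := by
  have hae : ∀ᵐ z ∂μ, z ∈ Φ.good := by have h := compl_mem_ae_iff.2 hμ; rwa [compl_compl] at h
  have hkin := Φ.aemeasurable_intervalIntegral_comp_flow_torus (measurable_visKinN hρm husm hA₀m hA₄m hAm R K N) s
    (s + τ * ((N : ℝ) + 1) ^ (-(1 / 3 : ℝ))) hμ
  have hflux := Φ.aemeasurable_intervalIntegral_comp_flow_torus (measurable_visFluxN (σ := σ) hρm husm hA₀m hA₄m hAm R K k N) s
    (s + τ * ((N : ℝ) + 1) ^ (-(1 / 3 : ℝ))) hμ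
  have hcoll := aemeasurable_collisionPairSum_visCollTermN (σ := σ) hρm husm hA₄m hAm R K Φ hs
    (s + τ * ((N : ℝ) + 1) ^ (-(1 / 3 : ℝ))) hμ
  refine (((hkin.add hcoll).sub hflux).const_mul (τ * ((N : ℝ) + 1) ^ (-(1 / 3 : ℝ)))⁻¹).congr ?_
  filter_upwards [hae] with z hz
  simp only [Pi.add_apply, Pi.sub_apply]
  rw [visCoreN_eq, finsum_visCollN_eq_collisionPairSum ρs us A₄ A R K hε Φ hz]

/-- **Additivity of `visCoreN` in the test fields on the good set**, all integrability side conditions of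
`visCoreN_add` discharged by the hard-sphere trajectory structure: good datum, continuous bounded reference drift,
measurable nonnegative reference density, continuous test fields, `0 ≤ K + ‖us‖_∞`, `0 ≤ σ`, block scale in
`0 < k (N+1)^{-1/3} < 1/2`, compressibility factor bounded on the capped EOS range. -/
theorem visCoreN_add_of_good {A₀' A₄' : T3 → V3} {A' : Fin 3 → T3 → V3} {K U k Zb : ℝ}
    (hρm : Measurable ρs) (hρs : ∀ x, 0 ≤ ρs x) (husc : Continuous us) (hus : ∀ x, ‖us x‖ ≤ U) (hV : 0 ≤ K + U)
    (hA₀ : Continuous A₀) (hA₄ : Continuous A₄) (hA : ∀ j, Continuous (A j))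
    (hA₀' : Continuous A₀') (hA₄' : Continuous A₄') (hA' : ∀ j, Continuous (A' j)) (hσ : 0 ≤ σ)
    (hk : 0 < k * ((N : ℝ) + 1) ^ (-(1 / 3 : ℝ))) (hk2 : k * ((N : ℝ) + 1) ^ (-(1 / 3 : ℝ)) < 1 / 2)
    (hZ : ∀ x, ∀ η ∈ Set.Icc 0 (2 * ρs x * σ ^ 3), |hsCompressibility η| ≤ Zb) (R τ : ℝ)
    (Φ : HardSphereFlow (Torus.geometry (Fin 3)) (hsDiameter σ N) (N + 1)) {z : Config (N + 1) (Fin 3) T3}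
    (hz : z ∈ Φ.good) (s : ℝ) :
    visCoreN σ ρs us (A₀ + A₀') (A₄ + A₄') (A + A') R K τ k N Φ s z =
      visCoreN σ ρs us A₀ A₄ A R K τ k N Φ s z + visCoreN σ ρs us A₀' A₄' A' R K τ k N Φ s z := by
  -- sup bounds of the continuous test fields on the compact torus
  obtain ⟨a₀, ha₀⟩ := isCompact_univ.exists_bound_of_continuousOn hA₀.continuousOn
  obtain ⟨a₄, ha₄⟩ := isCompact_univ.exists_bound_of_continuousOn hA₄.continuousOn
  obtain ⟨a₀', ha₀'⟩ := isCompact_univ.exists_bound_of_continuousOn hA₀'.continuousOn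
  obtain ⟨a₄', ha₄'⟩ := isCompact_univ.exists_bound_of_continuousOn hA₄'.continuousOn
  have hAb : ∀ (B : Fin 3 → T3 → V3), (∀ j, Continuous (B j)) → ∃ b, ∀ j x, ‖B j x‖ ≤ b := by
    intro B hB
    choose b hb using fun j => isCompact_univ.exists_bound_of_continuousOn (hB j).continuousOn
    exact ⟨Finset.univ.sup' Finset.univ_nonempty b, fun j x =>
      (hb j x (Set.mem_univ x)).trans (Finset.le_sup' b (Finset.mem_univ j))⟩
  obtain ⟨a, ha⟩ := hAb A hA
  obtain ⟨a', ha'⟩ := hAb A' hA'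
  have husm := husc.measurable
  refine visCoreN_add σ ρs us R K k N τ Φ s z hA₄ hA hA₄' hA'
    (Φ.finite_collisionTimes_inter hz Set.Ioc_subset_Icc_self)
    (intervalIntegrable_visKinN_flow hρm husm hA₀.measurable hA₄.measurable (fun j => (hA j).measurable)
      (fun x => ha₀ x (Set.mem_univ x)) ha (fun x => ha₄ x (Set.mem_univ x)) hus hV R Φ hz _ _)
    (intervalIntegrable_visKinN_flow hρm husm hA₀'.measurable hA₄'.measurable (fun j => (hA' j).measurable)
      (fun x => ha₀' x (Set.mem_univ x)) ha' (fun x => ha₄' x (Set.mem_univ x)) hus hV R Φ hz _ _)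
    (fun r => (integrable_visFluxDensityN_and_abs_visFluxN_le hρm husm hA₀.measurable hA₄.measurable
      (fun j => (hA j).measurable) hus hV hk hk2 hσ (fun x => ha₀ x (Set.mem_univ x)) ha (fun x => ha₄ x (Set.mem_univ x))
      hρs hZ _).1)
    (fun r => (integrable_visFluxDensityN_and_abs_visFluxN_le hρm husm hA₀'.measurable hA₄'.measurable
      (fun j => (hA' j).measurable) hus hV hk hk2 hσ (fun x => ha₀' x (Set.mem_univ x)) ha' (fun x => ha₄' x (Set.mem_univ x))
      hρs hZ _).1)
    (intervalIntegrable_visFluxN_flow hρm husm hA₀.measurable hA₄.measurable (fun j => (hA j).measurable) hus hV hk hk2 hσ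
      (fun x => ha₀ x (Set.mem_univ x)) ha (fun x => ha₄ x (Set.mem_univ x)) hρs hZ R Φ hz _ _)
    (intervalIntegrable_visFluxN_flow hρm husm hA₀'.measurable hA₄'.measurable (fun j => (hA' j).measurable) hus hV hk hk2 hσ
      (fun x => ha₀' x (Set.mem_univ x)) ha' (fun x => ha₄' x (Set.mem_univ x)) hρs hZ R Φ hz _ _)

end Assembly

/-! ## The registered toolkit stub -/

/-- **Registered toolkit stub `stub_visCoreNToolkitC` (part C)** of skeleton v7 (crux stmt-17740): the measurable good
version of `visCoreN` (a.e.-measurability under every law carried by the good set), additivity of `visCoreN` in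
continuous test fields at every good datum, and integrability over `𝕋³` plus the visible-particle bound of the flux
piece.  Sorry-free conjunction of `aemeasurable_visCoreN`, `visCoreN_add_of_good`,
`integrable_visFluxDensityN_and_abs_visFluxN_le`. -/
theorem stub_visCoreNToolkitC : (∀ (σ : ℝ) (N : ℕ) (ρs : Literature.MathematicalPhysics.KineticTheory.T3 → ℝ) (us A₀ A₄ : Literature.MathematicalPhysics.KineticTheory.T3 → Literature.MathematicalPhysics.KineticTheory.V3) (A : Fin 3 → Literature.MathematicalPhysics.KineticTheory.T3 → Literature.MathematicalPhysics.KineticTheory.V3), Literature.MathematicalPhysics.KineticTheory.hsDiameter σ N < 2⁻¹ → Measurable ρs → Measurable us → Measurable A₀ → Measurable A₄ → (∀ j, Measurable (A j)) → ∀ (R K τ k : ℝ) (Φ : Literature.Analysis.FluidPDE.HardSphereFlow (Literature.Analysis.FluidPDE.Torus.geometry (Fin 3)) (Literature.MathematicalPhysics.KineticTheory.hsDiameter σ N) (N + 1)) (s : ℝ), 0 ≤ s → ∀ μ : MeasureTheory.Measure (Literature.Analysis.FluidPDE.Config (N + 1) (Fin 3) Literature.MathematicalPhysics.KineticTheory.T3),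 μ Φ.goodᶜ = 0 → AEMeasurable (Summit.AtomisticToContinuum.HydrodynamicLimit.Theorems.LTEInBand.visCoreN σ ρs us A₀ A₄ A R K τ k N Φ s) μ) ∧ (∀ (σ : ℝ) (N : ℕ) (ρs : Literature.MathematicalPhysics.KineticTheory.T3 → ℝ) (us A₀ A₄ A₀' A₄' : Literature.MathematicalPhysics.KineticTheory.T3 → Literature.MathematicalPhysics.KineticTheory.V3) (A A' : Fin 3 → Literature.MathematicalPhysics.KineticTheory.T3 → Literature.MathematicalPhysics.KineticTheory.V3) (K U k Zb : ℝ), Measurable ρs → (∀ x, 0 ≤ ρs x) → Continuous us → (∀ x, ‖us x‖ ≤ U) → 0 ≤ K + U → Continuous A₀ → Continuous A₄ → (∀ j, Continuous (A j)) → Continuous A₀' → Continuous A₄' → (∀ j, Continuous (A' j)) → 0 ≤ σ → 0 < k * ((N : ℝ) + 1) ^ (-(1 / 3 : ℝ)) → k * ((N : ℝ) + 1) ^ (-(1 / 3 : ℝ)) < 1 / 2 → (∀ x, ∀ η ∈ Set.Icc 0 (2 * ρs x * σ ^ 3), |Literature.MathematicalPhysics.KineticTheory.hsCompressibility η| ≤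 Zb) → ∀ (R τ : ℝ) (Φ : Literature.Analysis.FluidPDE.HardSphereFlow (Literature.Analysis.FluidPDE.Torus.geometry (Fin 3)) (Literature.MathematicalPhysics.KineticTheory.hsDiameter σ N) (N + 1)) (z : Literature.Analysis.FluidPDE.Config (N + 1) (Fin 3) Literature.MathematicalPhysics.KineticTheory.T3), z ∈ Φ.good → ∀ s : ℝ, Summit.AtomisticToContinuum.HydrodynamicLimit.Theorems.LTEInBand.visCoreN σ ρs us (A₀ + A₀') (A₄ + A₄') (A + A') R K τ k N Φ s z = Summit.AtomisticToContinuum.HydrodynamicLimit.Theorems.LTEInBand.visCoreN σ ρs us A₀ A₄ A R K τ k N Φ s z + Summit.AtomisticToContinuum.HydrodynamicLimit.Theorems.LTEInBand.visCoreN σ ρs us A₀' A₄' A' R K τ k N Φ s z) ∧ (∀ (σ : ℝ) (N : ℕ) (ρs : Literature.MathematicalPhysics.KineticTheory.T3 → ℝ) (us A₀ A₄ : Literature.MathematicalPhysics.KineticTheory.T3 → Literature.MathematicalPhysics.KineticTheory.V3) (A : Fin 3 → Literature.MathematicalPhysics.KineticTheory.T3 → Literature.MathematicalPhysics.KineticTheory.V3)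 (R K U k a₀ a a₄ Zb : ℝ), Measurable ρs → Measurable us → Measurable A₀ → Measurable A₄ → (∀ j, Measurable (A j)) → (∀ x, ‖us x‖ ≤ U) → 0 ≤ K + U → 0 < k * ((N : ℝ) + 1) ^ (-(1 / 3 : ℝ)) → k * ((N : ℝ) + 1) ^ (-(1 / 3 : ℝ)) < 1 / 2 → 0 ≤ σ → (∀ x, ‖A₀ x‖ ≤ a₀) → (∀ j x, ‖A j x‖ ≤ a) → (∀ x, ‖A₄ x‖ ≤ a₄) → (∀ x, 0 ≤ ρs x) → (∀ x, ∀ η ∈ Set.Icc 0 (2 * ρs x * σ ^ 3), |Literature.MathematicalPhysics.KineticTheory.hsCompressibility η| ≤ Zb) → ∀ y : Literature.Analysis.FluidPDE.Config (N + 1) (Fin 3) Literature.MathematicalPhysics.KineticTheory.T3, MeasureTheory.Integrable (Summit.AtomisticToContinuum.HydrodynamicLimit.Theorems.LTEInBand.visFluxDensityN σ ρs us A₀ A₄ A R K k N y) MeasureTheory.volume ∧ |Summit.AtomisticToContinuum.HydrodynamicLimit.Theorems.LTEInBand.visFluxN σ ρs us A₀ A₄ A R K k N y| ≤ ((N : ℝ)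 + 1) * (a₀ * (K + U) + 3 * a * (K + U) ^ 2 + a * (K + U) ^ 2 * Zb + a₄ * (K + U) ^ 3 * (1 / 2 + Zb / 3))) :=
  ⟨fun _ _ _ _ _ _ _ hε hρm husm hA₀m hA₄m hAm R K τ k Φ _ hs _ hμ =>
      aemeasurable_visCoreN hε hρm husm hA₀m hA₄m hAm R K τ k Φ hs hμ,
    fun _ _ _ _ _ _ _ _ _ _ _ _ _ _ hρm hρs husc hus hV hA₀ hA₄ hA hA₀' hA₄' hA' hσ hk hk2 hZ R τ Φ _ hz s =>
      visCoreN_add_of_good hρm hρs husc hus hV hA₀ hA₄ hA hA₀' hA₄' hA' hσ hk hk2 hZ R τ Φ hz s,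
    fun _ _ _ _ _ _ _ _ _ _ _ _ _ _ _ hρm husm hA₀m hA₄m hAm hus hV hk hk2 hσ hA₀ hA hA₄ hρs hZ y =>
      integrable_visFluxDensityN_and_abs_visFluxN_le hρm husm hA₀m hA₄m hAm hus hV hk hk2 hσ hA₀ hA hA₄ hρs hZ y⟩

end Summit.AtomisticToContinuum.HydrodynamicLimit.Theorems.LTEInBand

end
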